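import Literature.NumberTheory.Automorphic.Liu2021.NablaOfPieces
import Literature.NumberTheory.Automorphic.Liu2021.NablaGaloisDescent
import Literature.AlgebraicGeometry.Motives.FiberBaseChange
import Literature.AlgebraicGeometry.Motives.AbelianVarietyIsoOfScheme
import Literature.AlgebraicGeometry.Motives.AbelianVarietyComplexPoints
import Literature.AlgebraicGeometry.HodgeTheory.BettiUniverseIsoTransport
import HarnessLib

/-!
# Liu 2021 Lemma 2.4 (1) — helper lemmas for the proof at projective `X` (pieces, base change to `ℂ`, `H¹`)

Topic `Literature/NumberTheory/Automorphic/Liu2021` (piece «F6 helpers (i)–(iii)» of the (G)-road of the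
`hodgecm-mathlib` cell, carve `A-provers/A-p18/CARVE-G-road.md`; consumer: `Liu2021/Lemma24OfJacobianDimension`).
PROOF FILE: theorems only — no definition, no named fact, sorry-free (D-0026 ±0).

In the proof of Lemma 2.4 (1) ([Liu2021] l. 1220–1228: «we pick an element `x ∈ X(π₀(X ⊗_{k,τ} ℂ))` … the
induced map `(α_X)^*_x : H¹_{B,τ}(Alb, ℚ) → H¹_{B,τ}(X, ℚ)` is an isomorphism; it is independent of the choice
of `x` since translation acts trivially on `H¹_{B,τ}(Alb, ℚ)`») at a projective `X`, the Albanese variety is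
split over a finite Galois `L / k` into Jacobians of pointed geometrically irreducible pieces `E_j ⟶ X ⊗_k L`
(tree `Albanese.exists_isGalois_isLimit_fan_baseChange`), while the statement is over `ℂ` along
`k → L → ℂ` and in terms of an ARBITRARY decomposition `inj_c : Y_c ⟶ X ⊗_k ℂ` into geometrically irreducible
complex pieces.  This file supplies the three bookkeeping steps:

* §1 (**connected into a coproduct**) `exists_comp_eq_of_connectedSpace`: a morphism from a CONNECTED `B`-scheme
  to the apex of a colimit cofan `f_i : X_i ⟶ S` in `Over B` factors through exactly one leg (its image is
  preconnected, the images of the legs are open-closed and cover; Mathlib `IsPreconnected.subset_isClopen`,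
  `IsOpenImmersion.lift`), uniquely (`comp_eq_unique`, `index_unique`).
* §2 (**matching the pieces over `ℂ`**) `exists_equiv_iso_bcFunctor_piece`: along `k → L → ℂ`
  (`(algebraMap L ℂ) ∘ (algebraMap k L) = algebraMap k ℂ`), for a colimit cofan `e_j : E_j ⟶ X ⊗_k L` of
  geometrically irreducible `L`-schemes and a colimit cofan `inj_c : Y_c ⟶ X ⊗_k ℂ` of geometrically
  irreducible `ℂ`-schemes there are a BIJECTION `σ : κ ≃ C` of the index sets and isomorphisms
  `φ_c : E_{σ c} ⊗_L ℂ ≅ Y_c` OVER `X ⊗_k ℂ` (through the transitivity isomorphism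
  `(X ⊗_k L) ⊗_L ℂ ≅ X ⊗_k ℂ`, tree `baseChangeHomObjIsoOfComp`); per-index form
  `exists_iso_bcFunctor_piece`.  This is the public form of the matching step §E–§F inside the proof of
  `Albanese.exists_jacobian_hom_baseChange_of_ne_zero` (`Liu2021/AlbaneseBaseChangeJointlyEpi`), whose two private
  helpers are re-proved here.
* §3 (**`Hᵏ` along isomorphisms and translations**) `pull_bijective_of_iso` (tree `pullEquiv`),
  `pull_bijective_of_abelianVarietyIso` (an isomorphism of abelian varieties, through `overIsoOfIso`),
  `pull_mul_toSpecOver_comp` / `pull_toSpecOver_comp_mul` («translation acts trivially», tree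
  `bettiCohomology_map_mul_const/_const_mul`, spelled with `BettiUniverse.pull`), `pull_translate_eq_id`
  (the right translation `y ↦ y · a` of `A` acts as the identity on `Hᵏ(A(ℂ); ℚ)`).

Item (ii) of the carve — `IsSmoothProjective d (E ⊗_L ℂ)` from `IsSmoothProjective d E` — is the tree's
`IsSmoothProjective.baseChange_obj` (`Motives/BaseChangeProofs`) and is not restated.

## References

* [Liu2021] Y. Liu, *Fourier–Jacobi cycles and arithmetic relative trace formula*, arXiv:2102.11518 = Camb. J. Math. 9
  (2021): Lemma 2.4 (1) (l. 1210–1213) with proof (l. 1220–1228); §2.1 Def. 2.1 (2) (split schemes).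
* [GortzWedhorn2020] U. Görtz, T. Wedhorn, *Algebraic Geometry I*, 2nd ed. (2020): Lemma 1.19 (1) (§(1.5)),
  §(3.5) Example 3.11 (coproducts of schemes are disjoint unions), Prop. 4.16 (transitivity of base change),
  Prop. 4.32 (immersions under base change), Prop. 5.50 (ii).
* [HatcherAT2002] A. Hatcher, *Algebraic Topology*, CUP 2002, §3.1 p. 198 (functoriality), p. 201 (homotopy
  invariance).
* [MumfordAV1970] D. Mumford, *Abelian Varieties* (1970), §1 (1)–(2) (translations act trivially on cohomology).
-/

noncomputable section

open CategoryTheory CategoryTheory.Limits AlgebraicGeometry MonoidalCategory CartesianMonoidalCategory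
open Literature.AlgebraicGeometry.Motives Literature.AlgebraicGeometry.HodgeTheory
open scoped MonObj

universe v u

namespace Literature.NumberTheory.Automorphic.Liu2021.AppendixC

open AbelianVariety (bcSpec bcFunctor)

/-! ## §1 A connected scheme mapping to a coproduct factors through exactly one summand -/

section Connected

variable {B : Scheme.{u}} {σ : Type v} [Small.{u} σ] {X : σ → Over B} {S : Over B} {f : ∀ i, X i ⟶ S}

/-- **A connected `B`-scheme mapping to the apex of a colimit cofan `f_i : X_i ⟶ S` (in `Over B`) factors
through one of the legs**: its image is preconnected and meets the open-closed image of some leg (the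
images cover `S`), hence lies inside it (Mathlib `IsPreconnected.subset_isClopen`), and a morphism with image
inside the image of an open immersion lifts through it (Mathlib `IsOpenImmersion.lift`).
[cite: GortzWedhorn2020, Lemma 1.19 (1) (§(1.5)) with §(3.5) Example 3.11] -/
theorem exists_comp_eq_of_connectedSpace (hc : IsColimit (Cofan.mk S f)) {Z : Over B} [ConnectedSpace Z.left]
    (g : Z ⟶ S) : ∃ (i : σ) (h : Z ⟶ X i), h ≫ f i = g := by
  obtain ⟨hc'⟩ := Literature.AlgebraicGeometry.Morphisms.isColimit_cofan_left hc
  obtain ⟨z⟩ := (inferInstance : Nonempty Z.left)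
  obtain ⟨i, y, hy⟩ := Literature.AlgebraicGeometry.Morphisms.exists_eq_of_isColimit_cofan hc' (g.left z)
  have hsub : Set.range ⇑g.left ⊆ Set.range ⇑(f i).left :=
    (isPreconnected_range g.left.continuous).subset_isClopen
      (Literature.AlgebraicGeometry.Morphisms.isClopen_range_of_isColimit_cofan hc' i) ⟨g.left z, ⟨z, rfl⟩, y, hy⟩
  haveI := Literature.AlgebraicGeometry.Morphisms.isOpenImmersion_of_isColimit_cofan hc' i
  have hfac : IsOpenImmersion.lift (f i).left g.left hsub ≫ (f i).left = g.left := IsOpenImmersion.lift_fac _ _ _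
  refine ⟨i, Over.homMk (IsOpenImmersion.lift (f i).left g.left hsub) ?_, Over.OverMorphism.ext hfac⟩
  rw [← Over.w (f i), ← Category.assoc, hfac, Over.w g]

/-- The factorisation through a given leg is unique (the legs of a colimit cofan of schemes are open
immersions, hence monomorphisms). [cite: GortzWedhorn2020, §(3.5) Example 3.11] -/
theorem comp_eq_unique (hc : IsColimit (Cofan.mk S f)) {Z : Over B} {g : Z ⟶ S} {i : σ} (h h' : Z ⟶ X i)
    (hh : h ≫ f i = g) (hh' : h' ≫ f i = g) : h = h' := by
  obtain ⟨hc'⟩ := Literature.AlgebraicGeometry.Morphisms.isColimit_cofan_left hc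
  haveI := Literature.AlgebraicGeometry.Morphisms.isOpenImmersion_of_isColimit_cofan hc' i
  haveI : Mono (f i) := Over.mono_of_mono_left _
  rw [← cancel_mono (f i), hh, hh']

/-- The leg through which a morphism from a NON-EMPTY scheme factors is unique (the images of distinct legs
are disjoint). [cite: GortzWedhorn2020, §(3.5) Example 3.11] -/
theorem index_unique (hc : IsColimit (Cofan.mk S f)) {Z : Over B} [Nonempty Z.left] {g : Z ⟶ S} {i j : σ}
    (h : Z ⟶ X i) (h' : Z ⟶ X j) (hh : h ≫ f i = g) (hh' : h' ≫ f j = g) : i = j := by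
  obtain ⟨hc'⟩ := Literature.AlgebraicGeometry.Morphisms.isColimit_cofan_left hc
  by_contra hne
  obtain ⟨z⟩ := (inferInstance : Nonempty Z.left)
  have hd : Disjoint (Set.range ⇑(f i).left) (Set.range ⇑(f j).left) :=
    Literature.AlgebraicGeometry.Morphisms.pairwise_disjoint_range_of_isColimit_cofan hc' hne
  have h1 : (f i).left (h.left z) = g.left z := by rw [← Scheme.Hom.comp_apply, ← Over.comp_left, hh]
  have h2 : (f j).left (h'.left z) = g.left z := by rw [← Scheme.Hom.comp_apply, ← Over.comp_left, hh']
  exact Set.disjoint_left.1 hd ⟨h.left z, h1⟩ ⟨h'.left z, h2⟩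

end Connected

/-! ## §2 Matching two decompositions into geometrically irreducible pieces along `k → L → ℂ` -/

section Matching

/-- Two families of connected open-closed subsets, the first of which covers the space: every member of the
second family EQUALS some member of the first (`IsPreconnected.subset_isClopen` both ways).  (Re-proof of the
private helper of `Liu2021/AlbaneseBaseChangeJointlyEpi`.) [cite: GortzWedhorn2020, Lemma 1.19 (1) (§(1.5))] -/
theorem exists_range_eq_of_isClopen_of_isConnected {α : Type*} [TopologicalSpace α] {I J : Type*}
    {A : I → Set α} {B : J → Set α} (hAc : ∀ i, IsClopen (A i)) (hAconn : ∀ i, _root_.IsConnected (A i))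
    (hAcov : ∀ x, ∃ i, x ∈ A i) (hBc : ∀ j, IsClopen (B j)) (hBconn : ∀ j, _root_.IsConnected (B j)) (j : J) :
    ∃ i, A i = B j := by
  obtain ⟨x, hx⟩ := (hBconn j).nonempty
  obtain ⟨i, hi⟩ := hAcov x
  exact ⟨i, Set.Subset.antisymm ((hAconn i).isPreconnected.subset_isClopen (hBc j) ⟨x, hi, hx⟩)
    ((hBconn j).isPreconnected.subset_isClopen (hAc i) ⟨x, hx, hi⟩)⟩

/-- The image of `g ≫ i` for an isomorphism `i` of `K`-schemes is the preimage of the image of `g` under `i⁻¹`.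
(Re-proof of the private helper of `Liu2021/AlbaneseBaseChangeJointlyEpi`.) [cite: GortzWedhorn2020, §(3.5)] -/
theorem range_comp_left_eq_preimage {K : Type u} [Field K] {W X₁ X₂ : SchemeOver K} (g : W ⟶ X₁)
    (i : X₁ ≅ X₂) : Set.range ⇑(g ≫ i.hom).left = ⇑i.inv.left ⁻¹' Set.range ⇑g.left := by
  have h1 : ∀ z, i.inv.left (i.hom.left z) = z := fun z => by
    rw [← Scheme.Hom.comp_apply, ← Over.comp_left, i.hom_inv_id, Over.id_left]; rfl
  have h2 : ∀ z, i.hom.left (i.inv.left z) = z := fun z => by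
    rw [← Scheme.Hom.comp_apply, ← Over.comp_left, i.inv_hom_id, Over.id_left]; rfl
  ext x
  constructor
  · rintro ⟨y, rfl⟩
    exact ⟨y, by rw [Over.comp_left, Scheme.Hom.comp_apply, h1]⟩
  · rintro ⟨y, hy⟩
    exact ⟨y, by rw [Over.comp_left, Scheme.Hom.comp_apply, hy, h2]⟩

variable {k L : Type} [Field k] [Field L] [Algebra k L] [Algebra k ℂ] [Algebra L ℂ]
  (hτ : (algebraMap L ℂ).comp (algebraMap k L) = algebraMap k ℂ) (X : SchemeOver k)
  {C : Type} (E : C → SchemeOver L) (e : ∀ j, E j ⟶ (bcFunctor k L).obj X)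
  [∀ j, GeometricallyIrreducible (E j).hom]
  {κ : Type} (Y : κ → SchemeOver ℂ) [∀ c, GeometricallyIrreducible (Y c).hom]
  (inj : ∀ c, Y c ⟶ (bcFunctor k ℂ).obj X)

/-- **Matching the pieces over `ℂ` (with the reindexing bijection).**  Along `k → L → ℂ` let
`e_j : E_j ⟶ X ⊗_k L` be a colimit cofan of geometrically irreducible `L`-schemes (e.g. the pointed pieces
over a finite Galois splitting field) and `inj_c : Y_c ⟶ X ⊗_k ℂ` a colimit cofan of geometrically irreducible
complex schemes (e.g. the connected components) — no finiteness needed.  Then there are a bijection `σ : κ ≃ C` and isomorphisms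
`φ_c : E_{σ c} ⊗_L ℂ ≅ Y_c` over `X ⊗_k ℂ`: `φ_c ≫ inj_c = (e_{σ c} ⊗_L ℂ) ≫ ((X ⊗_k L) ⊗_L ℂ ≅ X ⊗_k ℂ)`.
Both families are the connected components of `X ⊗_k ℂ` (open-closed, connected, covering, pairwise disjoint
images), and two open immersions with the same image are isomorphic over the target
(Mathlib `IsOpenImmersion.isoOfRangeEq`). [cite: Liu2021, §2.1 Def. 2.1 (2) and proof of Lemma 2.4 (1) (l. 1220–1228)]
[cite: GortzWedhorn2020, §(3.5) Example 3.11 and Prop. 4.16] -/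
theorem exists_equiv_iso_bcFunctor_piece (hcolL : IsColimit (Cofan.mk ((bcFunctor k L).obj X) e))
    (hcol : IsColimit (Cofan.mk ((bcFunctor k ℂ).obj X) inj)) :
    ∃ (σ : κ ≃ C) (φ : ∀ c, (bcFunctor L ℂ).obj (E (σ c)) ≅ Y c),
      ∀ c, (φ c).hom ≫ inj c =
        (bcFunctor L ℂ).map (e (σ c)) ≫
          (baseChangeHomObjIsoOfComp (algebraMap k L) (algebraMap L ℂ) (algebraMap k ℂ) hτ X).hom := by
  classical
  set eX : (bcFunctor L ℂ).obj ((bcFunctor k L).obj X) ≅ (bcFunctor k ℂ).obj X :=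
    baseChangeHomObjIsoOfComp (algebraMap k L) (algebraMap L ℂ) (algebraMap k ℂ) hτ X with heX
  let f : ∀ j, (bcFunctor L ℂ).obj (E j) ⟶ (bcFunctor k ℂ).obj X := fun j => (bcFunctor L ℂ).map (e j) ≫ eX.hom
  haveI hoe : ∀ j, IsOpenImmersion (e j).left := fun j => isOpenImmersion_left_of_isColimit hcolL j
  haveI hof : ∀ j, IsOpenImmersion (f j).left := fun j => by
    haveI := GaloisDescent.isOpenImmersion_bcFunctor_map_left ℂ (e j)
    change IsOpenImmersion (((bcFunctor L ℂ).map (e j)).left ≫ eX.hom.left)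
    infer_instance
  have hrange : ∀ j, Set.range ⇑(f j).left =
      ⇑eX.inv.left ⁻¹' (⇑(pullback.fst ((bcFunctor k L).obj X).hom (bcSpec L ℂ)) ⁻¹' Set.range ⇑(e j).left) :=
    fun j => by rw [range_comp_left_eq_preimage, GaloisDescent.range_bcFunctor_map_left]; rfl
  have hfclopen : ∀ j, IsClopen (Set.range ⇑(f j).left) := fun j => by
    rw [hrange j]
    exact ((isClopen_range_left_of_isColimit hcolL j).preimage (Scheme.Hom.continuous _)).preimage
      (Scheme.Hom.continuous _)
  have hfconn : ∀ j, _root_.IsConnected (Set.range ⇑(f j).left) := fun j => by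
    haveI : GeometricallyIrreducible ((bcFunctor L ℂ).obj (E j)).hom :=
      inferInstanceAs (GeometricallyIrreducible (pullback.snd (E j).hom (bcSpec L ℂ)))
    haveI : IrreducibleSpace ↥((bcFunctor L ℂ).obj (E j)).left :=
      GeometricallyIrreducible.irreducibleSpace_of_subsingleton ((bcFunctor L ℂ).obj (E j)).hom
    exact isConnected_range (f j).left.continuous
  have hfcov : ∀ x : ↥((bcFunctor k ℂ).obj X).left, ∃ j, x ∈ Set.range ⇑(f j).left := fun x => by
    obtain ⟨j, y, hy⟩ := exists_eq_left_of_isColimit hcolL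
      (pullback.fst ((bcFunctor k L).obj X).hom (bcSpec L ℂ) (eX.inv.left x))
    exact ⟨j, by rw [hrange j]; exact ⟨y, hy⟩⟩
  have hfdisj : ∀ {j j' : C}, j ≠ j' → Disjoint (Set.range ⇑(f j).left) (Set.range ⇑(f j').left) :=
    fun {j j'} h => by
      rw [hrange j, hrange j']
      exact ((disjoint_range_left_of_isColimit hcolL h).preimage _).preimage _
  haveI hoinj : ∀ c, IsOpenImmersion (inj c).left := fun c => isOpenImmersion_left_of_isColimit hcol c
  have hYclopen : ∀ c, IsClopen (Set.range ⇑(inj c).left) := fun c => isClopen_range_left_of_isColimit hcol c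
  have hYconn : ∀ c, _root_.IsConnected (Set.range ⇑(inj c).left) := fun c => by
    haveI : IrreducibleSpace ↥(Y c).left := GeometricallyIrreducible.irreducibleSpace_of_subsingleton (Y c).hom
    exact isConnected_range (inj c).left.continuous
  have hYcov : ∀ x : ↥((bcFunctor k ℂ).obj X).left, ∃ c, x ∈ Set.range ⇑(inj c).left := fun x => by
    obtain ⟨c, y, hy⟩ := exists_eq_left_of_isColimit hcol x
    exact ⟨c, y, hy⟩
  have hYdisj : ∀ {c c' : κ}, c ≠ c' → Disjoint (Set.range ⇑(inj c).left) (Set.range ⇑(inj c').left) :=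
    fun {c c'} h => disjoint_range_left_of_isColimit hcol h
  -- matching: every `Y_c` is some `E_{j(c)} ⊗ ℂ`, and every `E_j ⊗ ℂ` is hit exactly once
  have hmatch : ∀ c, ∃ j, Set.range ⇑(f j).left = Set.range ⇑(inj c).left := fun c =>
    exists_range_eq_of_isClopen_of_isConnected hfclopen hfconn hfcov hYclopen hYconn c
  choose jOf hjOf using hmatch
  have hsurj : Function.Surjective jOf := fun j => by
    obtain ⟨c, hc⟩ := exists_range_eq_of_isClopen_of_isConnected hYclopen hYconn hYcov hfclopen hfconn j
    refine ⟨c, ?_⟩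
    by_contra hne
    have hd := hfdisj hne
    rw [hjOf c, ← hc, Set.disjoint_iff_inter_eq_empty, Set.inter_self] at hd
    exact (hYconn c).nonempty.ne_empty hd
  have hinj : Function.Injective jOf := fun c c' hcc' => by
    by_contra hne
    have hd := hYdisj hne
    rw [← hjOf c, ← hjOf c', hcc', Set.disjoint_iff_inter_eq_empty, Set.inter_self] at hd
    exact (hfconn (jOf c')).nonempty.ne_empty hd
  -- the isomorphisms `E_{j(c)} ⊗ ℂ ≅ Y_c` over `X ⊗_k ℂ`
  have hisoY : ∀ c, ∃ φ : (bcFunctor L ℂ).obj (E (jOf c)) ≅ Y c, φ.hom ≫ inj c = f (jOf c) := fun c => by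
    let i₀ := IsOpenImmersion.isoOfRangeEq (f (jOf c)).left (inj c).left (hjOf c)
    have hfac : i₀.hom ≫ (inj c).left = (f (jOf c)).left := IsOpenImmersion.isoOfRangeEq_hom_fac _ _ _
    refine ⟨Over.isoMk i₀ ?_, Over.OverMorphism.ext hfac⟩
    rw [← Over.w (inj c), ← Category.assoc, hfac]
    exact Over.w (f (jOf c))
  choose φ hφ using hisoY
  exact ⟨Equiv.ofBijective jOf ⟨hinj, hsurj⟩, φ, hφ⟩

/-- **Matching the pieces over `ℂ`, per index**: each `E_j ⊗_L ℂ` is isomorphic OVER `X ⊗_k ℂ` to one of the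
`Y_c` («`e_{j,ℂ}` factors through one `inj_c`», as an isomorphism).
[cite: Liu2021, §2.1 Def. 2.1 (2) and proof of Lemma 2.4 (1) (l. 1220–1228)] [cite: GortzWedhorn2020, §(3.5) Example 3.11 and Prop. 4.16] -/
theorem exists_iso_bcFunctor_piece (hcolL : IsColimit (Cofan.mk ((bcFunctor k L).obj X) e))
    (hcol : IsColimit (Cofan.mk ((bcFunctor k ℂ).obj X) inj)) (j : C) :
    ∃ (c : κ) (ψ : (bcFunctor L ℂ).obj (E j) ≅ Y c),
      ψ.hom ≫ inj c =
        (bcFunctor L ℂ).map (e j) ≫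
          (baseChangeHomObjIsoOfComp (algebraMap k L) (algebraMap L ℂ) (algebraMap k ℂ) hτ X).hom := by
  obtain ⟨σ, φ, hφ⟩ := exists_equiv_iso_bcFunctor_piece hτ X E e Y inj hcolL hcol
  obtain ⟨c, rfl⟩ : ∃ c, σ c = j := ⟨σ.symm j, σ.apply_symm_apply j⟩
  exact ⟨c, φ c, hφ c⟩

/-- **Matching the pieces over `ℂ` along an ARBITRARY identification `eX : (X ⊗_k L) ⊗_L ℂ ≅ X ⊗_k ℂ`**
(currency-free form of `exists_equiv_iso_bcFunctor_piece` above: `eX` may be `baseChangeHomObjIsoOfComp … hτ X` or a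
component `(AbelianVariety.bcFunctorTowerIso k L ℂ).app X` of the tower isomorphism — the proof uses only that `eX`
is an isomorphism over `Spec ℂ`).  For a colimit cofan `e_j : E_j ⟶ X ⊗_k L` of geometrically irreducible
`L`-schemes and a colimit cofan `inj_c : Y_c ⟶ X ⊗_k ℂ` of geometrically irreducible complex schemes there are a
bijection `σ : κ ≃ C` and isomorphisms `φ_c : E_{σ c} ⊗_L ℂ ≅ Y_c` with `φ_c ≫ inj_c = (e_{σ c} ⊗_L ℂ) ≫ eX`.
[cite: Liu2021, §2.1 Def. 2.1 (2) and proof of Lemma 2.4 (1) (l. 1220–1228)]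
[cite: GortzWedhorn2020, §(3.5) Example 3.11 and Prop. 4.16] -/
theorem exists_equiv_iso_piece_of_iso (eX : (bcFunctor L ℂ).obj ((bcFunctor k L).obj X) ≅ (bcFunctor k ℂ).obj X)
    (hcolL : IsColimit (Cofan.mk ((bcFunctor k L).obj X) e))
    (hcol : IsColimit (Cofan.mk ((bcFunctor k ℂ).obj X) inj)) :
    ∃ (σ : κ ≃ C) (φ : ∀ c, (bcFunctor L ℂ).obj (E (σ c)) ≅ Y c),
      ∀ c, (φ c).hom ≫ inj c = (bcFunctor L ℂ).map (e (σ c)) ≫ eX.hom := by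
  classical
  let f : ∀ j, (bcFunctor L ℂ).obj (E j) ⟶ (bcFunctor k ℂ).obj X := fun j => (bcFunctor L ℂ).map (e j) ≫ eX.hom
  haveI hoe : ∀ j, IsOpenImmersion (e j).left := fun j => isOpenImmersion_left_of_isColimit hcolL j
  haveI hof : ∀ j, IsOpenImmersion (f j).left := fun j => by
    haveI := GaloisDescent.isOpenImmersion_bcFunctor_map_left ℂ (e j)
    change IsOpenImmersion (((bcFunctor L ℂ).map (e j)).left ≫ eX.hom.left)
    infer_instance
  have hrange : ∀ j, Set.range ⇑(f j).left =
      ⇑eX.inv.left ⁻¹' (⇑(pullback.fst ((bcFunctor k L).obj X).hom (bcSpec L ℂ)) ⁻¹' Set.range ⇑(e j).left) :=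
    fun j => by rw [range_comp_left_eq_preimage, GaloisDescent.range_bcFunctor_map_left]; rfl
  have hfclopen : ∀ j, IsClopen (Set.range ⇑(f j).left) := fun j => by
    rw [hrange j]
    exact ((isClopen_range_left_of_isColimit hcolL j).preimage (Scheme.Hom.continuous _)).preimage
      (Scheme.Hom.continuous _)
  have hfconn : ∀ j, _root_.IsConnected (Set.range ⇑(f j).left) := fun j => by
    haveI : GeometricallyIrreducible ((bcFunctor L ℂ).obj (E j)).hom :=
      inferInstanceAs (GeometricallyIrreducible (pullback.snd (E j).hom (bcSpec L ℂ)))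
    haveI : IrreducibleSpace ↥((bcFunctor L ℂ).obj (E j)).left :=
      GeometricallyIrreducible.irreducibleSpace_of_subsingleton ((bcFunctor L ℂ).obj (E j)).hom
    exact isConnected_range (f j).left.continuous
  have hfcov : ∀ x : ↥((bcFunctor k ℂ).obj X).left, ∃ j, x ∈ Set.range ⇑(f j).left := fun x => by
    obtain ⟨j, y, hy⟩ := exists_eq_left_of_isColimit hcolL
      (pullback.fst ((bcFunctor k L).obj X).hom (bcSpec L ℂ) (eX.inv.left x))
    exact ⟨j, by rw [hrange j]; exact ⟨y, hy⟩⟩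
  have hfdisj : ∀ {j j' : C}, j ≠ j' → Disjoint (Set.range ⇑(f j).left) (Set.range ⇑(f j').left) :=
    fun {j j'} h => by
      rw [hrange j, hrange j']
      exact ((disjoint_range_left_of_isColimit hcolL h).preimage _).preimage _
  haveI hoinj : ∀ c, IsOpenImmersion (inj c).left := fun c => isOpenImmersion_left_of_isColimit hcol c
  have hYclopen : ∀ c, IsClopen (Set.range ⇑(inj c).left) := fun c => isClopen_range_left_of_isColimit hcol c
  have hYconn : ∀ c, _root_.IsConnected (Set.range ⇑(inj c).left) := fun c => by
    haveI : IrreducibleSpace ↥(Y c).left := GeometricallyIrreducible.irreducibleSpace_of_subsingleton (Y c).hom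
    exact isConnected_range (inj c).left.continuous
  have hYcov : ∀ x : ↥((bcFunctor k ℂ).obj X).left, ∃ c, x ∈ Set.range ⇑(inj c).left := fun x => by
    obtain ⟨c, y, hy⟩ := exists_eq_left_of_isColimit hcol x
    exact ⟨c, y, hy⟩
  have hYdisj : ∀ {c c' : κ}, c ≠ c' → Disjoint (Set.range ⇑(inj c).left) (Set.range ⇑(inj c').left) :=
    fun {c c'} h => disjoint_range_left_of_isColimit hcol h
  -- matching: every `Y_c` is some `E_{j(c)} ⊗ ℂ`, and every `E_j ⊗ ℂ` is hit exactly once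
  have hmatch : ∀ c, ∃ j, Set.range ⇑(f j).left = Set.range ⇑(inj c).left := fun c =>
    exists_range_eq_of_isClopen_of_isConnected hfclopen hfconn hfcov hYclopen hYconn c
  choose jOf hjOf using hmatch
  have hsurj : Function.Surjective jOf := fun j => by
    obtain ⟨c, hc⟩ := exists_range_eq_of_isClopen_of_isConnected hYclopen hYconn hYcov hfclopen hfconn j
    refine ⟨c, ?_⟩
    by_contra hne
    have hd := hfdisj hne
    rw [hjOf c, ← hc, Set.disjoint_iff_inter_eq_empty, Set.inter_self] at hd
    exact (hYconn c).nonempty.ne_empty hd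
  have hinj : Function.Injective jOf := fun c c' hcc' => by
    by_contra hne
    have hd := hYdisj hne
    rw [← hjOf c, ← hjOf c', hcc', Set.disjoint_iff_inter_eq_empty, Set.inter_self] at hd
    exact (hfconn (jOf c')).nonempty.ne_empty hd
  -- the isomorphisms `E_{j(c)} ⊗ ℂ ≅ Y_c` over `X ⊗_k ℂ`
  have hisoY : ∀ c, ∃ φ : (bcFunctor L ℂ).obj (E (jOf c)) ≅ Y c, φ.hom ≫ inj c = f (jOf c) := fun c => by
    let i₀ := IsOpenImmersion.isoOfRangeEq (f (jOf c)).left (inj c).left (hjOf c)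
    have hfac : i₀.hom ≫ (inj c).left = (f (jOf c)).left := IsOpenImmersion.isoOfRangeEq_hom_fac _ _ _
    refine ⟨Over.isoMk i₀ ?_, Over.OverMorphism.ext hfac⟩
    rw [← Over.w (inj c), ← Category.assoc, hfac]
    exact Over.w (f (jOf c))
  choose φ hφ using hisoY
  exact ⟨Equiv.ofBijective jOf ⟨hinj, hsurj⟩, φ, hφ⟩

/-- Matching along an arbitrary identification `eX`, per index: each `E_j ⊗_L ℂ` is isomorphic over `X ⊗_k ℂ`
(via `eX`) to one of the `Y_c`. [cite: Liu2021, §2.1 Def. 2.1 (2) and proof of Lemma 2.4 (1) (l. 1220–1228)]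
[cite: GortzWedhorn2020, §(3.5) Example 3.11 and Prop. 4.16] -/
theorem exists_iso_piece_of_iso (eX : (bcFunctor L ℂ).obj ((bcFunctor k L).obj X) ≅ (bcFunctor k ℂ).obj X)
    (hcolL : IsColimit (Cofan.mk ((bcFunctor k L).obj X) e))
    (hcol : IsColimit (Cofan.mk ((bcFunctor k ℂ).obj X) inj)) (j : C) :
    ∃ (c : κ) (ψ : (bcFunctor L ℂ).obj (E j) ≅ Y c), ψ.hom ≫ inj c = (bcFunctor L ℂ).map (e j) ≫ eX.hom := by
  obtain ⟨σ, φ, hφ⟩ := exists_equiv_iso_piece_of_iso X E e Y inj eX hcolL hcol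
  obtain ⟨c, rfl⟩ : ∃ c, σ c = j := ⟨σ.symm j, σ.apply_symm_apply j⟩
  exact ⟨c, φ c, hφ c⟩

end Matching

/-! ## §3 `Hᵏ` along isomorphisms and translations, spelled with `BettiUniverse.pull` -/

section Betti

/-- **The pull-back along an isomorphism of complex varieties is bijective on `Hᵏ(−(ℂ); ℚ)`**
(tree `BettiUniverse.pullEquiv`). [cite: HatcherAT2002, §3.1 p. 198] -/
theorem pull_bijective_of_iso {X X' : SchemeOver ℂ} (e : X ≅ X') (k : ℕ) :
    Function.Bijective (BettiUniverse.pull e.hom k) :=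
  (BettiUniverse.pullEquiv e k).symm.bijective

/-- The same for the inverse. [cite: HatcherAT2002, §3.1 p. 198] -/
theorem pull_inv_bijective_of_iso {X X' : SchemeOver ℂ} (e : X ≅ X') (k : ℕ) :
    Function.Bijective (BettiUniverse.pull e.inv k) :=
  (BettiUniverse.pullEquiv e k).bijective

/-- **The pull-back along an isomorphism of complex abelian varieties is bijective on `Hᵏ`** (underlying
isomorphism of `ℂ`-schemes `AbelianVariety.overIsoOfIso`). [cite: HatcherAT2002, §3.1 p. 198] -/
theorem pull_bijective_of_abelianVarietyIso {A B : AbelianVariety ℂ} (j : A ≅ B) (k : ℕ) :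
    Function.Bijective (BettiUniverse.pull j.hom.hom.hom.hom k) :=
  pull_bijective_of_iso (AbelianVariety.overIsoOfIso j) k

/-- **Translation acts trivially on `Hᵏ(Alb(ℂ); ℚ)`** (right translates): for `f : X → A` and `a ∈ A(ℂ)`,
`(f · a)^* = f^*` on `Hᵏ` — tree `AbelianVariety.bettiCohomology_map_mul_const` spelled with `BettiUniverse.pull`
(«it is independent of the choice of `x` since translation acts trivially», l. 1227–1228).
[cite: Liu2021, proof of Lemma 2.4 (1) (l. 1227–1228)] [cite: HatcherAT2002, §3.1 p. 201] -/
theorem pull_mul_toSpecOver_comp {A : AbelianVariety ℂ} {X : SchemeOver ℂ} (f : X ⟶ A.X)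
    (a : A.Points ℂ) (k : ℕ) :
    BettiUniverse.pull (f * (toSpecOver X ≫ a)) k = BettiUniverse.pull f k :=
  congrArg (fun g => g.hom) (AbelianVariety.bettiCohomology_map_mul_const f a k)

/-- Left translates: `(a · f)^* = f^*` on `Hᵏ`. [cite: Liu2021, proof of Lemma 2.4 (1) (l. 1227–1228)]
[cite: HatcherAT2002, §3.1 p. 201] -/
theorem pull_toSpecOver_comp_mul {A : AbelianVariety ℂ} {X : SchemeOver ℂ} (f : X ⟶ A.X)
    (a : A.Points ℂ) (k : ℕ) :
    BettiUniverse.pull ((toSpecOver X ≫ a) * f) k = BettiUniverse.pull f k :=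
  congrArg (fun g => g.hom) (AbelianVariety.bettiCohomology_map_const_mul f a k)

/-- **The right translation `y ↦ y · a` of a complex abelian variety acts as the identity on `Hᵏ(A(ℂ); ℚ)`**
(it is the right translate of `𝟙_A`; Mumford §1 (1)–(2)). [cite: MumfordAV1970, §1 (1)–(2)] [cite: HatcherAT2002, §3.1 p. 201] -/
theorem pull_translate_eq_id {A : AbelianVariety ℂ} (a : A.Points ℂ) (k : ℕ) :
    BettiUniverse.pull (𝟙 A.X * (toSpecOver A.X ≫ a)) k = LinearMap.id := by
  rw [pull_mul_toSpecOver_comp, BettiUniverse.pull_id]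

/-- Hence the right translation is bijective on `Hᵏ`. [cite: MumfordAV1970, §1 (1)–(2)] -/
theorem pull_translate_bijective {A : AbelianVariety ℂ} (a : A.Points ℂ) (k : ℕ) :
    Function.Bijective (BettiUniverse.pull (𝟙 A.X * (toSpecOver A.X ≫ a)) k) := by
  rw [pull_translate_eq_id]
  exact Function.bijective_id

end Betti

end Literature.NumberTheory.Automorphic.Liu2021.AppendixC

end
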